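import Literature.Combinatorics.Designs.DifferenceSetDevelopment
import Mathlib.Data.ZMod.Basic

/-!
# (+) control C+M5 in the kernel: the Singer `(133, 12, 1)` difference set and the cyclic plane `PG(2, 11)`
Framing: lottery ticket; floor = certified bounds/negative ranges.

Cell `pub-namedobj`, target M, family B2 (difference-set type planes). The census control C+M5 ('the (133,12,1) Singer
difference set of PG(2,11) re-found by the multiplier pipeline', two engines, g13) as kernel facts: the explicit set
`{1, 8, 9, 11, 25, 37, 69, 88, 94, 99, 103, 121} ⊆ ℤ/133` is a planar difference set (`IsDifferenceSet _ 1`, Literature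
`DifferenceSetMultiplier`), has 12 elements, is fixed by the multiplier `11` — all by `decide` (kernel evaluation,
no `native_decide`) — and therefore (Literature `DifferenceSetDevelopment`, Singer sufficiency) its development is a
projective plane of order 11 in Mathlib's sense: `exists_projectivePlane_order_eleven`. Positive companion of the
kernel exclusions `NoOrder157.lean` (order 12) and `MOLS/NoCyclicPlaneOrder10.lean` (order 10): the same machinery
that kills the non-prime-power orders certifies the prime-power order 11. Replication of a classical object
(Singer 1938); zero compute; no `sorry`, no new axioms.
-/
namespace Summit.Ventures.DiscreteObjects.PP12

open Finset
open Literature.Combinatorics.Designs.DifferenceSets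

/-- the Singer difference set of `PG(2,11)` found by the multiplier `11` (union of four orbits of `x ↦ 11x` on
`ℤ/133`): `{1, 8, 9, 11, 25, 37, 69, 88, 94, 99, 103, 121}` (local notation, not a definition). -/
local notation "singer133" =>
  ({1, 8, 9, 11, 25, 37, 69, 88, 94, 99, 103, 121} : Finset (ZMod 133))

/-- **(+) control C+M5 in the kernel: a planar `(133, 12, 1)` difference set exists** (the Singer cycle of
`PG(2, 11)`), so the multiplier-theorem pipeline that kills `(157, 13, 1)` (order 12, `NoOrder157.lean`) and
`(111, 11, 1)` (order 10) does NOT kill order 11: the set `{1, 8, 9, 11, 25, 37, 69, 88, 94, 99, 103, 121} ⊆ ℤ/133`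
(fixed by the multiplier `11`) is a difference set with `λ = 1`, checked by `decide`. -/
theorem singer133_isDifferenceSet : IsDifferenceSet singer133 1 := by
  unfold IsDifferenceSet
  decide +kernel

/-- it has `12 = 11 + 1` elements -/
theorem singer133_card : (singer133).card = 12 := by decide

/-- and it is fixed by the multiplier `11` (as Hall's theorem predicts: `11 ∣ n = 11`, `11 > λ = 1`). -/
theorem singer133_mul_eleven : (singer133).image (fun x => (11 : ZMod 133) * x) = singer133 := by decide

/-- **PG(2, 11) in the kernel as a cyclic plane: a projective plane of order 11 exists** (Mathlib
`Configuration.ProjectivePlane`), namely the development of the Singer set — points `ℤ/133`, lines the translates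
`D + g` (`DevLine`, Literature `DifferenceSetDevelopment`). A (+) control for the whole difference-set chain. -/
theorem exists_projectivePlane_order_eleven :
    ∃ (P L : Type) (_ : Membership P L) (_ : Fintype P) (_ : Fintype L) (_ : Configuration.ProjectivePlane P L),
      Configuration.ProjectivePlane.order P L = 11 := by
  refine ⟨ZMod 133, DevLine singer133, inferInstance, inferInstance, inferInstance,
    singer133_isDifferenceSet.projectivePlane (by rw [singer133_card]; norm_num), ?_⟩
  rw [singer133_isDifferenceSet.order_projectivePlane, singer133_card]

end Summit.Ventures.DiscreteObjects.PP12
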